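import Summits.AtomisticToContinuum.BoseEinsteinCondensation.Theorems.BECRieszReverseHolderCoarseGrainedReverseHolderReduction
import Summits.AtomisticToContinuum.BoseEinsteinCondensation.Theorems.BECCutLineWeakDisorderGroundStateRigidityStubExistsNonnegGroundState
import HarnessLib

/-!
# Route `BECRieszReverseHolder`, crux `CoarseGrainedReverseHolder` (stmt-AtomisticToContinuum-12840):
# the crux is EQUIVALENT to its restriction to non-negative ground states

Supports (does not close) stmt-AtomisticToContinuum-12840 (line `registered`). Companion of
`BECRieszReverseHolderCoarseGrainedReverseHolderReduction.lean`, which proves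
`coarseGrainedReverseHolder_of_groundStates` (a uniform bound on the coarse-grained reverse-Hölder
functional `F_{n,ℓ}` over non-negative GROUND STATES implies the crux, which quantifies over
non-negative `δ`-near-minimisers with `δ` after `N`). Here the converse:

* `groundStates_of_coarseGrainedReverseHolder` — the crux bounds `F_{n,ℓ}` on non-negative ground
  states with the SAME thresholds and constant. A non-negative ground state `Φ` is the `L²`-limit of
  trial states with energies `→ E₀` (definition of the closed form, `Converse.exists_tendstoL2_energy_le`),
  hence — diamagnetic regularised moduli `√(ε² + |Ψ|²) − ε`, the `ExistsNonneg` toolkit of crux 9072,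
  keeping track of the sign (`Converse.exists_tendstoL2_nonneg`) — of NON-NEGATIVE trial states
  `Θ_j → Φ` with `liminf energy ≤ E₀ < E₀ + δ`; for a `Θ_j` that is both `δ`-near-minimising and
  `η`-close, `F(Φ) ≤ F(Θ_j) + 8m³η ≤ C + 8m³η` (`SliceLipschitz.coarseRH2_lipschitz`), for every `η > 0`.
* `coarseGrainedReverseHolder_iff_groundStates` — the equivalence. Consequently the open content of
  the crux is exactly a statement about non-negative ground states (the registered stub
  `stub_groundStateShadowDomination` + route item `RieszShadowFieldMoment` being one sufficient route,
  `coarseGrainedReverseHolder_of_shadowDomination`).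
-/

noncomputable section

open MeasureTheory Filter Matrix
open scoped ENNReal NNReal BigOperators Topology

namespace Summit.AtomisticToContinuum.BoseEinsteinCondensation.Theorems.CoarseGrainedReverseHolder

open Literature.MathematicalPhysics.QuantumManyBody
open Summit.AtomisticToContinuum.BoseEinsteinCondensation.Theses.BECRieszReverseHolder

namespace Converse

open GroundStateRigidity.ExistsNonneg

variable {N : ℕ} {L : ℝ}

/-- **A ground state is the `L²`-limit of a minimising sequence**: if `Φ` is a ground state there are
trial states `Ψ_j → Φ` in `L²` with `energy Ψ_j ≤ E₀ + 1/(j+1)` (the closed energy of `Φ` is the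
infimum of `liminf` energies over approximating sequences and equals `E₀ < ⊤`; pick, for each `j`, a
member of a `1/(j+1)`-good sequence that is both `1/(j+1)`-close and `1/(j+1)`-near-minimising). -/
theorem exists_tendstoL2_energy_le {v : ℝ → ℝ≥0∞} {Φ : BoseGas.Config N → ℂ}
    (h : BoseGas.IsGroundState v L Φ) :
    ∃ Ψ : ℕ → BoseGas.TrialState N L, BoseGas.TendstoL2 Ψ Φ ∧
      ∀ j, BoseGas.energy v (Ψ j) ≤ BoseGas.groundStateEnergy v N L + ((j + 1 : ℕ) : ℝ≥0∞)⁻¹ := by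
  have hE := h.groundStateEnergy_ne_top
  have hε : ∀ j : ℕ, (0 : ℝ≥0∞) < ((j + 1 : ℕ) : ℝ≥0∞)⁻¹ := fun j =>
    ENNReal.inv_pos.2 (ENNReal.natCast_ne_top _)
  have hex : ∀ j : ℕ, ∃ Ψ : BoseGas.TrialState N L,
      BoseGas.energy v Ψ < BoseGas.groundStateEnergy v N L + ((j + 1 : ℕ) : ℝ≥0∞)⁻¹ ∧
      ∫⁻ X, (‖Ψ.ψ X - Φ X‖₊ : ℝ≥0∞) ^ 2 < ((j + 1 : ℕ) : ℝ≥0∞)⁻¹ := by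
    intro j
    have hlt : BoseGas.closedEnergy v L Φ <
        BoseGas.groundStateEnergy v N L + ((j + 1 : ℕ) : ℝ≥0∞)⁻¹ := by
      rw [h.closedEnergy_eq]
      exact ENNReal.lt_add_right hE (hε j).ne'
    obtain ⟨Θ, hΘ⟩ := iInf_lt_iff.1 hlt
    obtain ⟨hΘΦ, hlim⟩ := iInf_lt_iff.1 hΘ
    have hfr : ∃ᶠ k in atTop, BoseGas.energy v (Θ k) <
        BoseGas.groundStateEnergy v N L + ((j + 1 : ℕ) : ℝ≥0∞)⁻¹ :=
      frequently_lt_of_liminf_lt (h := hlim)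
    have hev : ∀ᶠ k in atTop, ∫⁻ X, (‖(Θ k).ψ X - Φ X‖₊ : ℝ≥0∞) ^ 2 < ((j + 1 : ℕ) : ℝ≥0∞)⁻¹ :=
      hΘΦ.eventually (gt_mem_nhds (hε j))
    obtain ⟨k, hk1, hk2⟩ := (hfr.and_eventually hev).exists
    exact ⟨Θ k, hk1, hk2⟩
  choose Ψ hΨ using hex
  refine ⟨Ψ, ?_, fun j => (hΨ j).1.le⟩
  have h0 : Tendsto (fun j : ℕ => ((j + 1 : ℕ) : ℝ≥0∞)⁻¹) atTop (𝓝 0) :=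
    ENNReal.tendsto_inv_nat_nhds_zero.comp (tendsto_add_atTop_nat 1)
  exact tendsto_of_tendsto_of_tendsto_of_le_of_le tendsto_const_nhds h0 (fun _ => zero_le)
    fun j => (hΨ j).2.le

/-- **Non-negative diamagnetic approximation.** If trial states `Ψ_j → Φ` in `L²` (`Φ` measurable)
with `energy v Ψ_j ≤ b_j → E₀`, then there are NON-NEGATIVE trial states `Θ_j` (`Θ_j = ‖Θ_j‖`
pointwise) with `Θ_j → |Φ|` in `L²` and `liminf energy v Θ_j ≤ E₀`: `Θ_j` is the normalised
regularised modulus `(√(ε_j² + |Ψ_j|²) − ε_j)/‖·‖₂`, `ε_j = 1/(j+1)` — its mass never vanishes since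
`‖Ψ_j‖₂ = 1` — whose energy is `≤ ‖·‖₂⁻² energy v Ψ_j` by the diamagnetic inequality, with
`‖·‖₂ → 1` (the proof of `ExistsNonneg.exists_tendstoL2_norm`, keeping track of the sign).
[cite: ReedSimonIV1978, §XIII.12 Thm XIII.46] -/
theorem exists_tendstoL2_nonneg (v : ℝ → ℝ≥0∞) {Ψ : ℕ → BoseGas.TrialState N L}
    {Φ : BoseGas.Config N → ℂ} (hΦm : Measurable Φ) (hL2 : BoseGas.TendstoL2 Ψ Φ) {E₀ : ℝ≥0∞}
    {b : ℕ → ℝ≥0∞} (hb : Tendsto b atTop (𝓝 E₀)) (hΨb : ∀ n, BoseGas.energy v (Ψ n) ≤ b n) :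
    ∃ Θ : ℕ → BoseGas.TrialState N L, (∀ n X, (Θ n).ψ X = (‖(Θ n).ψ X‖ : ℂ)) ∧
      BoseGas.TendstoL2 Θ (fun X => ((‖Φ X‖ : ℝ) : ℂ)) ∧
      liminf (fun n => BoseGas.energy v (Θ n)) atTop ≤ E₀ := by
  have hε : ∀ n : ℕ, (0 : ℝ) < 1 / ((n : ℝ) + 1) := fun n => Nat.one_div_pos_of_nat
  -- the regularised moduli
  obtain ⟨G, hG⟩ : ∃ G : ℕ → BoseGas.Config N → ℂ, G = fun (n : ℕ) (X : BoseGas.Config N) =>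
      ((Real.sqrt ((1 / ((n : ℝ) + 1)) ^ 2 + ∑ _j : Unit, ‖(Ψ n).ψ X‖ ^ 2) -
        1 / ((n : ℝ) + 1) : ℝ) : ℂ) := ⟨_, rfl⟩
  have hGc : ∀ n, ContDiff ℝ 1 (G n) := fun n => by
    rw [hG]; exact contDiff_sqrtRegC (Ψ n).contDiff (hε n)
  -- the limit `|Φ|` is normalised
  have hFm : Measurable fun X => ((‖Φ X‖ : ℝ) : ℂ) := Complex.measurable_ofReal.comp hΦm.norm
  have hF1 : ∫⁻ X, (‖((‖Φ X‖ : ℝ) : ℂ)‖₊ : ℝ≥0∞) ^ 2 = 1 := by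
    rw [← hL2.lintegral_nnnorm_sq_eq_one hΦm.aestronglyMeasurable]
    refine lintegral_congr fun X => ?_
    rw [Complex.nnnorm_real, nnnorm_norm]
  -- `Gₙ → |Φ|` in `L²`
  have hd : Tendsto (fun n => ∫⁻ X, (‖G n X - ((‖Φ X‖ : ℝ) : ℂ)‖₊ : ℝ≥0∞) ^ 2) atTop (𝓝 0) := by
    have hle : ∀ n : ℕ, ∫⁻ X, (‖G n X - ((‖Φ X‖ : ℝ) : ℂ)‖₊ : ℝ≥0∞) ^ 2 ≤
        2 * (ENNReal.ofReal ((1 / ((n : ℝ) + 1)) ^ 2) * volume (BoseGas.boxN N L)) +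
          2 * ∫⁻ X, (‖(Ψ n).ψ X - Φ X‖₊ : ℝ≥0∞) ^ 2 := by
      intro n
      calc ∫⁻ X, (‖G n X - ((‖Φ X‖ : ℝ) : ℂ)‖₊ : ℝ≥0∞) ^ 2
          ≤ ∫⁻ X, 2 * (BoseGas.boxN N L).indicator
              (fun _ => ENNReal.ofReal ((1 / ((n : ℝ) + 1)) ^ 2)) X +
              2 * (‖(Ψ n).ψ X - Φ X‖₊ : ℝ≥0∞) ^ 2 := by
            refine lintegral_mono fun X => ?_
            rw [hG]
            exact nnnorm_sqrtReg_sub_norm_sq_le (Ψ n) Φ (hε n) X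
        _ = _ := by
            rw [lintegral_add_left
                ((measurable_const.indicator (BoseGas.measurableSet_boxN N L)).const_mul _),
              lintegral_const_mul' _ _ ENNReal.ofNat_ne_top,
              lintegral_const_mul' _ _ ENNReal.ofNat_ne_top,
              lintegral_indicator_const (BoseGas.measurableSet_boxN N L)]
    have hlim : Tendsto (fun n : ℕ =>
        2 * (ENNReal.ofReal ((1 / ((n : ℝ) + 1)) ^ 2) * volume (BoseGas.boxN N L)) +
          2 * ∫⁻ X, (‖(Ψ n).ψ X - Φ X‖₊ : ℝ≥0∞) ^ 2) atTop (𝓝 0) := by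
      have h1 : Tendsto (fun n : ℕ => ENNReal.ofReal ((1 / ((n : ℝ) + 1)) ^ 2)) atTop (𝓝 0) := by
        have h := ENNReal.tendsto_ofReal (tendsto_one_div_add_atTop_nhds_zero_nat.pow 2)
        rwa [zero_pow two_ne_zero, ENNReal.ofReal_zero] at h
      have h2 := ENNReal.Tendsto.mul_const h1 (Or.inr (BoseGas.volume_boxN_lt_top N L).ne)
      rw [zero_mul] at h2
      have h3 := (ENNReal.Tendsto.const_mul h2 (Or.inr ENNReal.ofNat_ne_top) (a := 2)).add
        (ENNReal.Tendsto.const_mul hL2 (Or.inr ENNReal.ofNat_ne_top) (a := 2))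
      rwa [mul_zero, add_zero] at h3
    exact tendsto_of_tendsto_of_tendsto_of_le_of_le tendsto_const_nhds hlim (fun _ => zero_le) hle
  -- masses `→ 1`, and never zero (the mass of `Gₙ` vanishes only if `Ψₙ = 0` a.e.)
  have hm : Tendsto (fun n => ∫⁻ X, (‖G n X‖₊ : ℝ≥0∞) ^ 2) atTop (𝓝 1) :=
    tendsto_lintegral_nnnorm_sq (fun n => (hGc n).continuous.aestronglyMeasurable)
      hFm.aestronglyMeasurable hF1 hd
  have hm0 : ∀ n, ∫⁻ X, (‖G n X‖₊ : ℝ≥0∞) ^ 2 ≠ 0 := by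
    intro n h0
    have hGm : Measurable fun X => (‖G n X‖₊ : ℝ≥0∞) ^ 2 :=
      (hGc n).continuous.measurable.nnnorm.coe_nnreal_ennreal.pow_const 2
    have hae : ∀ᵐ X, (‖(Ψ n).ψ X‖₊ : ℝ≥0∞) ^ 2 = 0 := by
      filter_upwards [(lintegral_eq_zero_iff hGm).1 h0] with X hX
      have hX' : G n X = 0 := by simpa using hX
      rw [hG] at hX'
      dsimp only at hX'
      have hr : Real.sqrt ((1 / ((n : ℝ) + 1)) ^ 2 + ∑ _j : Unit, ‖(Ψ n).ψ X‖ ^ 2) -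
          1 / ((n : ℝ) + 1) = 0 := Complex.ofReal_eq_zero.1 hX'
      rw [Fintype.sum_unique] at hr
      have hψ : ‖(Ψ n).ψ X‖ = 0 :=
        (pow_eq_zero_iff two_ne_zero).1 (BoseGas.sqrtReg_eq_zero (sq_nonneg _) hr)
      simp [norm_eq_zero.1 hψ]
    have h1 : ∫⁻ X, (‖(Ψ n).ψ X‖₊ : ℝ≥0∞) ^ 2 = 0 :=
      (lintegral_congr_ae hae).trans lintegral_zero
    exact one_ne_zero ((Ψ n).norm_eq.symm.trans h1)
  -- the normalised trial states
  have hex : ∀ n, ∃ Θ : BoseGas.TrialState N L,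
      (Θ.ψ = fun X => ((Real.sqrt ((∫⁻ X, (‖G n X‖₊ : ℝ≥0∞) ^ 2).toReal)⁻¹ : ℝ) : ℂ) * G n X) ∧
        BoseGas.energy v Θ ≤ (∫⁻ X, (‖G n X‖₊ : ℝ≥0∞) ^ 2)⁻¹ * BoseGas.energy v (Ψ n) := by
    intro n
    obtain ⟨Θ, h1, h2⟩ := exists_trialState_of_le (Ψ n) (hGc n)
      (fun X hX => by rw [hG]; exact sqrtRegC_eq_zero ((Ψ n).eq_zero X hX) (hε n).le)
      (fun σ X => by rw [hG]; simp only [(Ψ n).symm σ X])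
      (fun X => by rw [hG]; exact nnnorm_sqrtRegC_sq_le _ (hε n) X)
      (fun X => by rw [hG]; exact kineticDensity_sqrtRegC_le (Ψ n).contDiff (hε n) X) (hm0 n)
    exact ⟨Θ, h1, h2 v⟩
  choose Θ hΘ using hex
  refine ⟨Θ, ?_, ?_, ?_⟩
  · -- non-negativity: `Θₙ = cₙ (√(εₙ² + |Ψₙ|²) − εₙ)` with `cₙ ≥ 0`
    intro n X
    rw [(hΘ n).1]
    dsimp only
    rw [hG]
    dsimp only
    rw [← Complex.ofReal_mul, Complex.norm_real, Real.norm_of_nonneg]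
    exact mul_nonneg (Real.sqrt_nonneg _)
      (BoseGas.sqrtReg_nonneg (hε n).le (Finset.sum_nonneg fun _ _ => sq_nonneg _))
  · -- the normalising constants `→ 1`, so `Θₙ → |Φ|`
    have hc : Tendsto (fun n => Real.sqrt ((∫⁻ X, (‖G n X‖₊ : ℝ≥0∞) ^ 2).toReal)⁻¹) atTop
        (𝓝 1) := by
      have h1 := (ENNReal.tendsto_toReal ENNReal.one_ne_top).comp hm
      rw [ENNReal.toReal_one] at h1
      have h2 := (Real.continuous_sqrt.tendsto _).comp (h1.inv₀ one_ne_zero)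
      rwa [inv_one, Real.sqrt_one] at h2
    refine (tendsto_lintegral_const_mul_sub (G := G) hFm hF1 hc hd).congr fun n => ?_
    beta_reduce
    rw [(hΘ n).1]
  · have hup : Tendsto (fun n => (∫⁻ X, (‖G n X‖₊ : ℝ≥0∞) ^ 2)⁻¹ * b n) atTop (𝓝 E₀) := by
      have h := hm.inv
      rw [inv_one] at h
      have h' := ENNReal.Tendsto.mul h (Or.inl one_ne_zero) hb (Or.inr ENNReal.one_ne_top)
      rwa [one_mul] at h'
    refine (liminf_le_liminf (Eventually.of_forall fun n => ?_)).trans hup.liminf_eq.le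
    exact (hΘ n).2.trans (mul_le_mul_right (hΨb n) _)

end Converse

/-- **The crux bounds the functional on non-negative ground states** (converse of
`coarseGrainedReverseHolder_of_groundStates`, same thresholds and constant): given
`CoarseGrainedReverseHolder` with data `ρ₀`, `C`, the eventual range and `δ = δ(n)`, a non-negative
ground state `Φ` at a large `n` is the `L²`-limit of NON-NEGATIVE trial states `Θ_j` with
`liminf energy ≤ E₀ < E₀ + δ` (`Converse.exists_tendstoL2_energy_le`,
`Converse.exists_tendstoL2_nonneg`), so for every `η > 0` some `Θ_j` is both a non-negative
`δ`-near-minimiser (`F(Θ_j) ≤ C`) and `η`-close to `Φ`, whence `F(Φ) ≤ C + 8m³η` by the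
`L²`-Lipschitz estimate (`SliceLipschitz.coarseRH2_lipschitz stub_sqSumDivLipschitz`); let `η → 0`. -/
theorem groundStates_of_coarseGrainedReverseHolder (hC : CoarseGrainedReverseHolder) :
    ∀ v : ℝ → ENNReal, BoseGas.IsRepulsiveFiniteRange v →
      ∃ ρ₀ : ℝ, 0 < ρ₀ ∧ ∀ ρ : ℝ, 0 < ρ → ρ < ρ₀ → ∀ ℓ : ℝ, 0 < ℓ → ∃ C : ℝ,
      ∀ᶠ n : ℕ in Filter.atTop,
        ∀ Φ : BoseGas.Config (n + 1) → ℂ,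
          BoseGas.IsGroundState v (BoseGas.sideLength ρ (n + 1)) Φ → (∀ X, Φ X = (‖Φ X‖ : ℂ)) →
          let L := BoseGas.sideLength ρ (n + 1)
          let m := ⌊L / ℓ⌋₊
          (m : ENNReal) ^ 3 * ∫⁻ X : Fin n → EuclideanSpace ℝ (Fin 3),
              ((∑ k : Fin 3 → Fin m,
                  (∫⁻ y in {y : EuclideanSpace ℝ (Fin 3) |
                      ∀ i, y i ∈ Set.Ico ((k i : ℝ) * (L / m)) (((k i : ℝ) + 1) * (L / m))},
                    (‖Φ (Matrix.vecCons y X)‖₊ : ENNReal) ^ 2) ^ 2) /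
                (∫⁻ y, (‖Φ (Matrix.vecCons y X)‖₊ : ENNReal) ^ 2))
            ≤ ENNReal.ofReal C := by
  intro v hv
  obtain ⟨ρ₀, hρ₀, h⟩ := hC v hv
  refine ⟨ρ₀, hρ₀, fun ρ hρ hρlt ℓ hℓ => ?_⟩
  obtain ⟨C, hCev⟩ := h ρ hρ hρlt ℓ hℓ
  refine ⟨C, ?_⟩
  filter_upwards [hCev] with n hn
  obtain ⟨δ, hδ, hΨ⟩ := hn
  intro Φ hgs hpos
  dsimp only at hΨ ⊢
  simp only [CoarseRH2.setOf_forall_mem_Ico_eq_subCell] at hΨ ⊢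
  -- non-negative near-minimising approximants of `Φ`
  have hE := hgs.groundStateEnergy_ne_top
  obtain ⟨Ψs, hL2, hEs⟩ := Converse.exists_tendstoL2_energy_le hgs
  have hb : Tendsto (fun j : ℕ => BoseGas.groundStateEnergy v (n + 1) (BoseGas.sideLength ρ (n + 1)) +
      ((j + 1 : ℕ) : ℝ≥0∞)⁻¹) atTop
      (𝓝 (BoseGas.groundStateEnergy v (n + 1) (BoseGas.sideLength ρ (n + 1)))) := by
    have h0 := (ENNReal.tendsto_inv_nat_nhds_zero.comp (tendsto_add_atTop_nat 1)).const_add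
      (BoseGas.groundStateEnergy v (n + 1) (BoseGas.sideLength ρ (n + 1)))
    rwa [add_zero] at h0
  obtain ⟨Θ, hΘpos, hΘL2, hΘlim⟩ := Converse.exists_tendstoL2_nonneg v hgs.measurable hL2 hb hEs
  have hΦeq : (fun X => ((‖Φ X‖ : ℝ) : ℂ)) = Φ := funext fun X => (hpos X).symm
  rw [hΦeq] at hΘL2
  have hfr : ∃ᶠ j in atTop, BoseGas.energy v (Θ j) <
      BoseGas.groundStateEnergy v (n + 1) (BoseGas.sideLength ρ (n + 1)) + δ :=
    frequently_lt_of_liminf_lt (h := hΘlim.trans_lt (ENNReal.lt_add_right hE hδ.ne'))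
  -- `F(Φ) ≤ C + ε` for every `ε > 0`
  refine ENNReal.le_of_forall_pos_le_add fun ε hε _ => ?_
  have hM : (0 : ℝ) < 8 * ((⌊BoseGas.sideLength ρ (n + 1) / ℓ⌋₊ : ℕ) : ℝ) ^ 3 + 8 := by positivity
  have hη : (0 : ℝ) < (ε : ℝ) / (8 * ((⌊BoseGas.sideLength ρ (n + 1) / ℓ⌋₊ : ℕ) : ℝ) ^ 3 + 8) :=
    div_pos (by exact_mod_cast hε) hM
  have hev : ∀ᶠ j in atTop, ∫⁻ X, (‖(Θ j).ψ X - Φ X‖₊ : ℝ≥0∞) ^ 2 ≤ ENNReal.ofReal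
      (((ε : ℝ) / (8 * ((⌊BoseGas.sideLength ρ (n + 1) / ℓ⌋₊ : ℕ) : ℝ) ^ 3 + 8)) ^ 2) :=
    (hΘL2.eventually (gt_mem_nhds (ENNReal.ofReal_pos.2 (by positivity)))).mono fun j hj => hj.le
  obtain ⟨j, hj1, hj2⟩ := (hfr.and_eventually hev).exists
  have hclose : ∫⁻ X, (‖Φ X - (Θ j).ψ X‖₊ : ℝ≥0∞) ^ 2 ≤ ENNReal.ofReal
      (((ε : ℝ) / (8 * ((⌊BoseGas.sideLength ρ (n + 1) / ℓ⌋₊ : ℕ) : ℝ) ^ 3 + 8)) ^ 2) := by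
    refine (lintegral_congr fun X => ?_).trans_le hj2
    rw [← neg_sub, nnnorm_neg]
  have key := SliceLipschitz.coarseRH2_lipschitz stub_sqSumDivLipschitz
    (BoseGas.sideLength ρ (n + 1) / ((⌊BoseGas.sideLength ρ (n + 1) / ℓ⌋₊ : ℕ) : ℝ))
    (⌊BoseGas.sideLength ρ (n + 1) / ℓ⌋₊) hη.le hgs.measurable (Θ j).contDiff.continuous.measurable
    hgs.norm_eq (Θ j).norm_eq hclose
  have hbound := hΨ (Θ j) hj1.le (hΘpos j)
  refine key.trans ((add_le_add hbound le_rfl).trans ?_)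
  gcongr
  -- `8 m³ η ≤ ε`
  calc ENNReal.ofReal (8 * ((⌊BoseGas.sideLength ρ (n + 1) / ℓ⌋₊ : ℕ) : ℝ) ^ 3 *
        ((ε : ℝ) / (8 * ((⌊BoseGas.sideLength ρ (n + 1) / ℓ⌋₊ : ℕ) : ℝ) ^ 3 + 8)))
      ≤ ENNReal.ofReal (ε : ℝ) := by
        refine ENNReal.ofReal_le_ofReal ?_
        rw [← mul_div_assoc, div_le_iff₀ hM]
        have h8 : (0 : ℝ) ≤ (ε : ℝ) := by exact_mod_cast hε.le
        nlinarith
    _ = ε := ENNReal.ofReal_coe_nnreal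

/-- **The crux is equivalent to its restriction to non-negative ground states.**
`CoarseGrainedReverseHolder ↔` (for every admissible `v`, small `ρ`, every `ℓ > 0` there is `C` with,
eventually in `n`, `F_{n,ℓ}(Φ) ≤ C` for every non-negative ground state `Φ` of `n+1` bosons in the
Dirichlet box of side `((n+1)/ρ)^{1/3}`). -/
theorem coarseGrainedReverseHolder_iff_groundStates :
    CoarseGrainedReverseHolder ↔
    ∀ v : ℝ → ENNReal, BoseGas.IsRepulsiveFiniteRange v →
      ∃ ρ₀ : ℝ, 0 < ρ₀ ∧ ∀ ρ : ℝ, 0 < ρ → ρ < ρ₀ → ∀ ℓ : ℝ, 0 < ℓ → ∃ C : ℝ,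
      ∀ᶠ n : ℕ in Filter.atTop,
        ∀ Φ : BoseGas.Config (n + 1) → ℂ,
          BoseGas.IsGroundState v (BoseGas.sideLength ρ (n + 1)) Φ → (∀ X, Φ X = (‖Φ X‖ : ℂ)) →
          let L := BoseGas.sideLength ρ (n + 1)
          let m := ⌊L / ℓ⌋₊
          (m : ENNReal) ^ 3 * ∫⁻ X : Fin n → EuclideanSpace ℝ (Fin 3),
              ((∑ k : Fin 3 → Fin m,
                  (∫⁻ y in {y : EuclideanSpace ℝ (Fin 3) |
                      ∀ i, y i ∈ Set.Ico ((k i : ℝ) * (L / m)) (((k i : ℝ) + 1) * (L / m))},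
                    (‖Φ (Matrix.vecCons y X)‖₊ : ENNReal) ^ 2) ^ 2) /
                (∫⁻ y, (‖Φ (Matrix.vecCons y X)‖₊ : ENNReal) ^ 2))
            ≤ ENNReal.ofReal C :=
  ⟨groundStates_of_coarseGrainedReverseHolder, coarseGrainedReverseHolder_of_groundStates⟩


/-- **Registered sub-goal `stub_groundStateBoundOfCrux` of crux stmt-AtomisticToContinuum-12840 (line
`registered`)**: the crux implies the uniform bound on `F_{n,ℓ}` over non-negative ground states —
`groundStates_of_coarseGrainedReverseHolder` under its registered name (with `stub_cruxOfGroundStateBound`: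
crux ⇔ ground-state bound). -/
theorem stub_groundStateBoundOfCrux : CoarseGrainedReverseHolder → ∀ v : ℝ → ENNReal, BoseGas.IsRepulsiveFiniteRange v → ∃ ρ₀ : ℝ, 0 < ρ₀ ∧ ∀ ρ : ℝ, 0 < ρ → ρ < ρ₀ → ∀ ℓ : ℝ, 0 < ℓ → ∃ C : ℝ, ∀ᶠ n : ℕ in Filter.atTop, ∀ Φ : BoseGas.Config (n + 1) → ℂ, BoseGas.IsGroundState v (BoseGas.sideLength ρ (n + 1)) Φ → (∀ X, Φ X = (‖Φ X‖ : ℂ)) → let L := BoseGas.sideLength ρ (n + 1); let m := ⌊L / ℓ⌋₊; (m : ENNReal) ^ 3 * ∫⁻ X : Fin n → EuclideanSpace ℝ (Fin 3), ((∑ k : Fin 3 → Fin m, (∫⁻ y in {y : EuclideanSpace ℝ (Fin 3) | ∀ i, y i ∈ Set.Ico ((k i : ℝ) * (L / m)) (((k i : ℝ) + 1) * (L / m))}, (‖Φ (Matrix.vecCons y X)‖₊ : ENNReal) ^ 2) ^ 2) / (∫⁻ y, (‖Φ (Matrix.vecCons y X)‖₊ : ENNReal) ^ 2)) ≤ ENNReal.ofReal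 C :=
  groundStates_of_coarseGrainedReverseHolder

end Summit.AtomisticToContinuum.BoseEinsteinCondensation.Theorems.CoarseGrainedReverseHolder

end
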